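import Mathlib
import Literature.NumberTheory.LFunctions.Zhang2022.SkeletonPartOne
import Literature.NumberTheory.LFunctions.Zhang2022.SkeletonPartOneB
import Literature.NumberTheory.LFunctions.Zhang2022.Section4PartialIntegration
import HarnessLib

/-!
# Zhang (2022), typed statements §4A: Lemmas 4.1–4.3 with their proof steps, the weight `g`
# ((4.1)–(4.3)) and `Z̃` ((4.4)–(4.6)) — Z22 pp. 16–19, tex L899–L1034

Topic `Literature/NumberTheory/LFunctions/Zhang2022` (Landau–Siegel audit tree; verdict-neutral).
Y. Zhang, *Discrete mean estimates and the Landau–Siegel zero*, arXiv:2211.02515v1 (2022)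
[Zhang2022LandauSiegel] — **an unrefereed manuscript under adjudication. Every `def … : Prop`
below is a CLAIM OF THE MANUSCRIPT, STATED (with its locator), NOT ASSERTED**; the theorems are
either unfolding bridges to the banked skeleton (`Skeleton.*`, files `SkeletonPartOne/OneB`) or
kernel-checked instances of tree theorems (`Lemma41.*` of `Section4PartialIntegration`,
`Lemma43.*` of `Section4Lemma43`, `GaussWeight.*` of `Section4GaussianWeight`, `GammaFactor.*` of
`Section4TildeZ`) at the manuscript's parameters. Nothing here bears on Theorems 1–2 of the source.

This is the campaign file `TypedSection04A` (cell siegel-zhang, D-0069, plan/FILES.tsv): one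
declaration per DAG node of `plan/DAG.tsv` in the span tex L899–L1034. The three lemma STATEMENTS
are banked skeleton nodes and are only referenced (never restated): `Z22:Lem4.1` =
`Skeleton.Lemma41`, `Z22:Lem4.2` = `Skeleton.Lemma42`, `Z22:Lem4.3` = `Skeleton.Lemma43`
(`SkeletonPartOne`, p403318); likewise the objects `Ω₁ = Skeleton.Omega1`, `Ω₂ = Skeleton.Omega2`,
`F = Skeleton.Fpoly`, `G = Skeleton.Gpoly`, `F(·,ψ̄) = Skeleton.FpolyBar`, `X₁ = Skeleton.X1`,
`X₄ = Skeleton.X4`, `Z̃ = Skeleton.tildeZW`, `g = Skeleton.gW`, `Z(s,ψχ) = Skeleton.Zpc`.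

| DAG node | page | decl(s) here | kind |
|---|---|---|---|
| Z22:§4.u001 (`Ω₁`) | p.16 | `mem_Omega1_iff` | bridge (proved) |
| Z22:§4.u002, Z22:Lem4.1 | p.16 | `FGBound`, `lemma41_iff` | display / bridge |
| Z22:Lem4.1.pf, §4.u003 | p.16 | `coefX1`, `X1_eq_Xsum`, `StieltjesF20`, `stieltjesF20_of_expansion` | claim + edge |
| Z22:§4.u004 | p.16 | `PowBounds`, `powBounds_of_mem_Omega1` | claim, PROVED |
| Z22:§4.u005 | p.16 | `F20Bound`, `f20Bound_of_expansion` | claim + edge |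
| Z22:§4.u006, Z22:Lem4.2 | p.17 | `FGProdBound`, `lemma42_iff` | display / bridge |
| Z22:Lem4.2.pf, §4.u007 | p.17 | `coefX4`, `X4_eq_Xsum`, `FGSubOneExpansion`, `StieltjesFG`, `stieltjesFG_of_one_le` | claims, 2nd PROVED |
| Z22:§4.u008 | p.17 | `FGPartialBound`, `fgPartialBound_of_expansion`, `lemma42_of_expansion` | claim + edges |
| Z22:§4.u009 (`Ω₂`) | p.17 | `mem_Omega2_iff` | bridge (proved) |
| Z22:§4.u010, Z22:Lem4.3 | p.17 | `LogDerivBound`, `lemma43_iff` | display / bridge |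
| Z22:Lem4.3.pf (prose), §4.u011 | p.17 | `discR`, `mem_Omega1_of_mem_Omega2`, `TwoSided88` | object, edge, claim |
| Z22:§4.u012–u014 | p.17 | `IsLogBranch`, `ReLogBound`, `LogDerivEq`, `logDerivEq_of_isLogBranch` | claims + edge |
| Z22:§4.u015–u019, (4.1) | pp.17–18 | `omega1W`, `GVertical`, `gVertical_of_ell_pos`, `GDouble`, `GaussLine`, `gaussLine_of_ell_pos`, `GLogForm`, `Eq41`, `eq41_of_ell_pos` | objects/claims, PROVED where marked |
| prose "g increasing, 0 < g < 1" | p.18 | `gW_pos`, `gW_lt_one`, `gW_mono` | PROVED |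
| Z22:(4.2), (4.3) | p.18 | `Eq42`, `eq42_of_ell_pos`, `Eq43`, `eq43_of_ell_pos` | claims, PROVED |
| Z22:§4.u020, (4.4) | p.18 | `tildeZW_eq`, `Eq44`, `eq44_of_isPrimitive` | bridge, claim PROVED (given primitivity of `ψχ`) |
| Z22:§4.u021, §4.u022 | p.18 | `InRange45`, `TildeZFormula` | range, claim |
| Z22:(4.5), (4.6) | pp.18–19 | `Eq45`, `Eq46` | claims |

Conventions (skel/INTERFACE.md §3): `Skeleton.ForAllLarge`, "`X ≪ Y`" ↦ `∃ C, … X ≤ C·Y`, norms for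
`|·|`. A Riemann–Stieltjes integral `∫ x^{s₀−s} dX(x)` of the source is rendered in its
integrated-by-parts form (the form in which the source uses it in the next line, "by partial
integration"); this is said in each docstring concerned.

## References

* Y. Zhang, arXiv:2211.02515v1 (2022), §4 pp. 16–19: Lemmas 4.1–4.3 and proofs, (4.1)–(4.6).
  [cite: Zhang2022LandauSiegel, §4 pp. 16–19]
* A. A. Karatsuba, *Basic Analytic Number Theory* (1993), Ch. 2 Lemma 4 (the source's "[15]",
  Borel–Carathéodory; tree `Lemma43.norm_logDeriv_le`). [cite: MontgomeryVaughan2007, Ch. 6, Lemma 6.2]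
-/

noncomputable section

open Complex Real ComplexConjugate

namespace Literature.NumberTheory.LFunctions.Zhang2022.Typed.Section04A

variable {D : ℕ} [NeZero D] (χ : DirichletCharacter ℂ D) (x : Skeleton.Chr D)

/-! ## Lemma 4.1 (Z22 p.16, tex L899–L921) -/

omit [NeZero D] in
/-- **Z22:§4.u001** — the region `Ω₁ = {s : 1/2 − (100𝓛)⁻¹log 𝓛 < σ < 1 + (100𝓛)⁻¹log 𝓛,
|t − 2πt₀| < 𝓛₁ + 5}` of Lemma 4.1, unfolded at the manuscript's parameters (the banked object
`Skeleton.Omega1 D` = the tree's `Lemma43.Omega1 𝓛 𝓛₁ t₀`).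
[cite: Zhang2022LandauSiegel, §4 Lemma 4.1 p.16] [Z22 p.16, tex L900] -/
theorem mem_Omega1_iff (D : ℕ) (s : ℂ) : s ∈ Skeleton.Omega1 D ↔
    1 / 2 - Real.log (Skeleton.ell D) / (100 * Skeleton.ell D) < s.re ∧
      s.re < 1 + Real.log (Skeleton.ell D) / (100 * Skeleton.ell D) ∧
      |s.im - 2 * π * Skeleton.t0 D| < Skeleton.ell1 D + 5 := Iff.rfl

/-- **Z22:§4.u002** — the display of Lemma 4.1, "`|F(s,ψ)| + |G(s,ψ)| ≪ 𝓛⁷⁹`", pointwise at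
`(ψ, s)` with the implied constant `C` explicit. CLAIM (a display; its quantified closure is the
banked node `Skeleton.Lemma41`, see `lemma41_iff`).
[cite: Zhang2022LandauSiegel, §4 Lemma 4.1 p.16] [Z22 p.16, tex L904] -/
def FGBound (C : ℝ) (s : ℂ) : Prop :=
  ‖Skeleton.Fpoly χ x s‖ + ‖Skeleton.Gpoly χ x s‖ ≤ C * Skeleton.ell D ^ 79

/-- **Z22:Lem4.1** is the banked node `Skeleton.Lemma41` ("for `ψ ∈ Ψ₁`, `s ∈ Ω₁`:
`|F| + |G| ≪ 𝓛⁷⁹`"): it is literally the `ForAllLarge`-closure of the display `FGBound`.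
[cite: Zhang2022LandauSiegel, §4 Lemma 4.1 p.16] [Z22 p.16, tex L899] -/
theorem lemma41_iff : Skeleton.Lemma41 ↔ ∃ C : ℝ, Skeleton.ForAllLarge fun D _ χ =>
    ∀ x ∈ Skeleton.PsiOne χ, ∀ s ∈ Skeleton.Omega1 D, FGBound χ x C s := Iff.rfl

/-- The normalised coefficients `c₁(n) = ν₂₀(n)ψ(n)n^{−s₀}` of `X₁(x,ψ) = Σ_{n≤x} c₁(n)` (§3 p.15).
[cite: Zhang2022LandauSiegel, §4 Lemma 4.1 (proof) p.16] -/
def coefX1 (n : ℕ) : ℂ :=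
  Skeleton.nu20 χ n * x.ψ (n : ZMod x.p) * (n : ℂ) ^ (-Skeleton.s0 D)

omit [NeZero D] in
/-- `X₁(x,ψ)` is the partial-sum function `Lemma41.Xsum c₁ 0 x` of the tree's partial-integration
file (so that `Lemma41.sum_mul_cpow_eq_one`, `Lemma41.norm_F20_le` apply to it verbatim).
[cite: Zhang2022LandauSiegel, §4 Lemma 4.1 (proof) p.16] -/
theorem X1_eq_Xsum (y : ℝ) : Skeleton.X1 χ x y = Lemma41.Xsum (coefX1 χ x) 0 y := by
  rw [Lemma41.Xsum_zero]; rfl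

/-- **Z22:§4.u003** — "By the Stieltjes integral we may write
`F(s,ψ)²⁰ = 1 + ∫₁^{D⁸⁰} x^{s₀−s} d{X₁(x,ψ)}`." Rendered in the integrated-by-parts form in which
the next line uses it: with `z = s₀ − s`,
`F(s,ψ)²⁰ = (D⁸⁰)^{z}X₁(D⁸⁰,ψ) − z∫₁^{D⁸⁰} X₁(x,ψ)x^{z−1}dx`
(the "`1 +`" is the term `n = 1`, absorbed: `1 + ∫₁^{b} x^{z}dX₁ = b^{z}X₁(b) − z∫₁^b X₁x^{z−1}dx`
since `X₁(1) = ν₂₀(1) = 1`). CLAIM (it rests on the expansion `F²⁰ = Σ_{n≤D⁸⁰} ν₂₀(n)ψ(n)n^{−s}` of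
§3 p.15; given that expansion it is a theorem, `stieltjesF20_of_expansion`).
[cite: Zhang2022LandauSiegel, §4 Lemma 4.1 (proof) p.16] [Z22 p.16, tex L910] -/
def StieltjesF20 (s : ℂ) : Prop :=
  Skeleton.Fpoly χ x s ^ 20 =
    (((D : ℝ) ^ 80 : ℝ) : ℂ) ^ (Skeleton.s0 D - s) * Skeleton.X1 χ x ((D : ℝ) ^ 80) -
      (Skeleton.s0 D - s) * ∫ y in (1 : ℝ)..(D : ℝ) ^ 80,
        Skeleton.X1 χ x y * (y : ℂ) ^ (Skeleton.s0 D - s - 1)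

/-- `⌊D⁸⁰⌋ = D⁸⁰` (cast bookkeeping). [folklore] -/
private theorem floor_pow80 (D : ℕ) : ⌊(D : ℝ) ^ 80⌋₊ = D ^ 80 := by
  rw [← Nat.cast_pow, Nat.floor_natCast]

omit [NeZero D] in
/-- `c₁(n)·n^{s₀−s} = ν₂₀(n)ψ(n)n^{−s}` for `n ≥ 1`. [folklore] -/
private theorem coefX1_mul_cpow {n : ℕ} (hn : n ≠ 0) (s : ℂ) :
    coefX1 χ x n * (n : ℂ) ^ (Skeleton.s0 D - s) =
      Skeleton.nu20 χ n * x.ψ (n : ZMod x.p) * (n : ℂ) ^ (-s) := by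
  have hn' : (n : ℂ) ≠ 0 := Nat.cast_ne_zero.mpr hn
  rw [coefX1, mul_assoc, ← Complex.cpow_add _ _ hn']
  congr 2
  ring

omit [NeZero D] in
/-- **Edge for Z22:§4.u003**: the Stieltjes/by-parts identity follows from the expansion
`F(s,ψ)²⁰ = Σ_{n≤D⁸⁰} ν₂₀(n)ψ(n)n^{−s}` (§3 p.15) by the tree's exact Abel summation
`Lemma41.sum_mul_cpow_eq_one`. [cite: Zhang2022LandauSiegel, §4 Lemma 4.1 (proof) p.16] -/
theorem stieltjesF20_of_expansion (hD : 1 ≤ D) (s : ℂ)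
    (hF20 : Skeleton.Fpoly χ x s ^ 20 =
      ∑ n ∈ Finset.Icc 1 (D ^ 80), Skeleton.nu20 χ n * x.ψ (n : ZMod x.p) * (n : ℂ) ^ (-s)) :
    StieltjesF20 χ x s := by
  have hb : (1 : ℝ) ≤ (D : ℝ) ^ 80 := one_le_pow₀ (by exact_mod_cast hD)
  have key := Lemma41.sum_mul_cpow_eq_one (coefX1 χ x) hb (Skeleton.s0 D - s)
  rw [floor_pow80] at key
  have hsum : ∑ n ∈ Finset.Icc 1 (D ^ 80), coefX1 χ x n * (n : ℂ) ^ (Skeleton.s0 D - s) =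
      ∑ n ∈ Finset.Icc 1 (D ^ 80), Skeleton.nu20 χ n * x.ψ (n : ZMod x.p) * (n : ℂ) ^ (-s) :=
    Finset.sum_congr rfl fun n hn => coefX1_mul_cpow χ x (by
      have := (Finset.mem_Icc.mp hn).1; omega) s
  rw [StieltjesF20, hF20, ← hsum, key]
  simp only [← X1_eq_Xsum]

/-- **Z22:§4.u004** — "For `s ∈ Ω₁` and `1 ≤ x ≤ D⁸⁰` we have `|x^{s₀−s}| ≪ 𝓛`,
`|d/dx(x^{s₀−s})| ≪ x⁻¹𝓛⁴⁰⁶`", with the implied constant `C` explicit. CLAIM — and a theorem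
(`powBounds_of_mem_Omega1`, `C = 1`). [cite: Zhang2022LandauSiegel, §4 Lemma 4.1 (proof) p.16] [Z22 p.16, tex L914] -/
def PowBounds (C : ℝ) (D : ℕ) (s : ℂ) : Prop :=
  ∀ y : ℝ, 1 ≤ y → y ≤ (D : ℝ) ^ 80 →
    ‖(y : ℂ) ^ (Skeleton.s0 D - s)‖ ≤ C * Skeleton.ell D ∧
      ‖deriv (fun u : ℝ => (u : ℂ) ^ (Skeleton.s0 D - s)) y‖ ≤ C * Skeleton.ell D ^ 406 / y

omit [NeZero D] in
/-- `D⁸⁰ = e^{80𝓛}` (`𝓛 = log D`, `D ≥ 1`). [folklore] -/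
private theorem pow80_eq_exp (hD : 1 ≤ D) : (D : ℝ) ^ 80 = Real.exp (80 * Skeleton.ell D) := by
  have hD0 : (0 : ℝ) < D := by exact_mod_cast hD
  rw [Skeleton.ell, show (80 : ℝ) * Real.log D = ((80 : ℕ) : ℝ) * Real.log D by norm_num,
    Real.exp_nat_mul, Real.exp_log hD0]

omit [NeZero D] in
/-- On `Ω₁`, `z = s₀ − s` has `Re z ≤ (100𝓛)⁻¹log 𝓛`, `|Re z| ≤ 1` and `|Im z| ≤ 𝓛⁴⁰⁵ + 5`
(for `𝓛 ≥ 32`, so that `(100𝓛)⁻¹log 𝓛 ≤ 1/2`). [cite: Zhang2022LandauSiegel, §4 Lemma 4.1 (proof) p.16] -/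
private theorem z_bounds {s : ℂ} (hL : 32 ≤ Skeleton.ell D) (hs : s ∈ Skeleton.Omega1 D) :
    (Skeleton.s0 D - s).re ≤ Real.log (Skeleton.ell D) / (100 * Skeleton.ell D) ∧
      |(Skeleton.s0 D - s).re| ≤ 1 ∧
      |(Skeleton.s0 D - s).im| ≤ Skeleton.ell D ^ (405 : ℝ) + 5 := by
  obtain ⟨h1, h2, h3⟩ := (mem_Omega1_iff D s).mp hs
  have hL0 : 0 < Skeleton.ell D := by linarith
  have hη : Real.log (Skeleton.ell D) / (100 * Skeleton.ell D) ≤ 1 / 2 := by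
    rw [div_le_iff₀ (by positivity)]
    have := Real.log_le_sub_one_of_pos hL0
    linarith
  have hre : (Skeleton.s0 D - s).re = 1 / 2 - s.re := by
    simp [Skeleton.s0, SmoothWeight.s0]
  have him : (Skeleton.s0 D - s).im = 2 * π * Skeleton.t0 D - s.im := by
    simp [Skeleton.s0, SmoothWeight.s0]
  refine ⟨by rw [hre]; linarith, ?_, ?_⟩
  · rw [hre, abs_le]; constructor <;> linarith
  · rw [him, show 2 * π * Skeleton.t0 D - s.im = -(s.im - 2 * π * Skeleton.t0 D) by ring, abs_neg]
    have h405 : Skeleton.ell D ^ (405 : ℝ) = Skeleton.ell1 D := by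
      rw [Skeleton.ell1, show (405 : ℝ) = ((405 : ℕ) : ℝ) by norm_num, Real.rpow_natCast]
    rw [h405]; exact h3.le

omit [NeZero D] in
/-- **Z22:§4.u004 holds** with `C = 1`, for `𝓛 ≥ 32` and `s ∈ Ω₁`: `|x^{s₀−s}| ≤ 𝓛^{4/5} ≤ 𝓛` and
`|d/dx x^{s₀−s}| = |z·x^{z−1}| ≤ 𝓛⁴⁰⁶/x` (tree `Lemma41.norm_cpow_le`, `norm_deriv_cpow_le`,
`norm_mul_le_rpow_406`). [cite: Zhang2022LandauSiegel, §4 Lemma 4.1 (proof) p.16] -/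
theorem powBounds_of_mem_Omega1 (hD : 1 ≤ D) (hL : 32 ≤ Skeleton.ell D) {s : ℂ}
    (hs : s ∈ Skeleton.Omega1 D) : PowBounds 1 D s := by
  intro y hy1 hyD
  have hL1 : 1 ≤ Skeleton.ell D := by linarith
  have hL0 : 0 < Skeleton.ell D := by linarith
  obtain ⟨hz, hre, him⟩ := z_bounds hL hs
  have hyX : y ≤ Real.exp (80 * Skeleton.ell D) := by rwa [← pow80_eq_exp hD]
  have h45 : Skeleton.ell D ^ (4 / 5 : ℝ) ≤ Skeleton.ell D := by
    conv_rhs => rw [← Real.rpow_one (Skeleton.ell D)]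
    exact Real.rpow_le_rpow_of_exponent_le hL1 (by norm_num)
  refine ⟨?_, ?_⟩
  · rw [one_mul]
    exact (Lemma41.norm_cpow_le hL1 hy1 hyX hz).trans h45
  · have hy0 : 0 < y := by linarith
    rw [(Lemma41.hasDerivAt_ofReal_cpow (Skeleton.s0 D - s) hy0).deriv, one_mul]
    calc ‖(Skeleton.s0 D - s) * (y : ℂ) ^ (Skeleton.s0 D - s - 1)‖
        ≤ ‖Skeleton.s0 D - s‖ * Skeleton.ell D ^ (4 / 5 : ℝ) / y :=
          Lemma41.norm_deriv_cpow_le hL1 hy1 hyX hz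
      _ ≤ Skeleton.ell D ^ (406 : ℝ) / y :=
          div_le_div_of_nonneg_right (Lemma41.norm_mul_le_rpow_406 hL hre him) hy0.le
      _ = Skeleton.ell D ^ 406 / y := by
          rw [show (406 : ℝ) = ((406 : ℕ) : ℝ) by norm_num, Real.rpow_natCast]

/-- **Z22:§4.u005** — "Hence, by partial integration,
`|F(s,ψ)|²⁰ ≪ 1 + 𝓛⁴⁰⁶(|X₁(D⁸⁰,ψ)| + ∫₁^{D⁸⁰} |X₁(x,ψ)|dx/x)`", with the implied constant `C`
explicit. CLAIM; given the expansion of `F²⁰` it is a theorem (`f20Bound_of_expansion`, `C = 1`).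
[cite: Zhang2022LandauSiegel, §4 Lemma 4.1 (proof) p.16] [Z22 p.16, tex L918] -/
def F20Bound (C : ℝ) (s : ℂ) : Prop :=
  ‖Skeleton.Fpoly χ x s‖ ^ 20 ≤ C * (1 + Skeleton.ell D ^ 406 *
    (‖Skeleton.X1 χ x ((D : ℝ) ^ 80)‖ + ∫ y in (1 : ℝ)..(D : ℝ) ^ 80, ‖Skeleton.X1 χ x y‖ / y))

omit [NeZero D] in
/-- **Edge for Z22:§4.u005**: for `𝓛 ≥ 32` and `s ∈ Ω₁`, the expansion
`F(s,ψ)²⁰ = Σ_{n≤D⁸⁰} ν₂₀(n)ψ(n)n^{−s}` gives the display with `C = 1` (tree `Lemma41.norm_F20_le`: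
`≤ 𝓛^{4/5}|X₁(D⁸⁰)| + 𝓛⁴⁰⁶∫|X₁|dx/x`). [cite: Zhang2022LandauSiegel, §4 Lemma 4.1 (proof) p.16] -/
theorem f20Bound_of_expansion (hD : 1 ≤ D) (hL : 32 ≤ Skeleton.ell D) {s : ℂ}
    (hs : s ∈ Skeleton.Omega1 D)
    (hF20 : Skeleton.Fpoly χ x s ^ 20 =
      ∑ n ∈ Finset.Icc 1 (D ^ 80), Skeleton.nu20 χ n * x.ψ (n : ZMod x.p) * (n : ℂ) ^ (-s)) :
    F20Bound χ x 1 s := by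
  have hL1 : 1 ≤ Skeleton.ell D := by linarith
  have hL0 : 0 < Skeleton.ell D := by linarith
  obtain ⟨hz, hre, him⟩ := z_bounds hL hs
  have hb : (1 : ℝ) ≤ (D : ℝ) ^ 80 := one_le_pow₀ (by exact_mod_cast hD)
  have hbX : (D : ℝ) ^ 80 ≤ Real.exp (80 * Skeleton.ell D) := (pow80_eq_exp hD).le
  have key := Lemma41.norm_F20_le (coefX1 χ x) hL hb hbX hz hre him
  rw [floor_pow80] at key
  have hsum : ∑ n ∈ Finset.Icc 1 (D ^ 80), coefX1 χ x n * (n : ℂ) ^ (Skeleton.s0 D - s) =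
      Skeleton.Fpoly χ x s ^ 20 := by
    rw [hF20]
    exact Finset.sum_congr rfl fun n hn => coefX1_mul_cpow χ x (by
      have := (Finset.mem_Icc.mp hn).1; omega) s
  rw [hsum, norm_pow] at key
  simp only [← X1_eq_Xsum] at key
  have hI0 : 0 ≤ ∫ y in (1 : ℝ)..(D : ℝ) ^ 80, ‖Skeleton.X1 χ x y‖ / y :=
    intervalIntegral.integral_nonneg hb fun y hy => div_nonneg (norm_nonneg _) (by linarith [hy.1])
  have h45 : Skeleton.ell D ^ (4 / 5 : ℝ) ≤ Skeleton.ell D ^ 406 := by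
    rw [show (Skeleton.ell D ^ 406 : ℝ) = Skeleton.ell D ^ ((406 : ℕ) : ℝ) from
      (Real.rpow_natCast _ _).symm]
    exact Real.rpow_le_rpow_of_exponent_le hL1 (by norm_num)
  have h406 : Skeleton.ell D ^ (406 : ℝ) = Skeleton.ell D ^ 406 := by
    rw [show (406 : ℝ) = ((406 : ℕ) : ℝ) by norm_num, Real.rpow_natCast]
  rw [h406] at key
  have hX0 : 0 ≤ ‖Skeleton.X1 χ x ((D : ℝ) ^ 80)‖ := norm_nonneg _
  unfold F20Bound
  nlinarith [mul_le_mul_of_nonneg_right h45 hX0, pow_nonneg hL0.le 406]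

/-! ## Lemma 4.2 (Z22 p.17, tex L925–L941) -/

/-- **Z22:§4.u006** — the display of Lemma 4.2, "`F(s,ψ)G(s,ψ) = 1 + O(𝓛⁻²²⁷)`", pointwise at
`(ψ, s)` with the implied constant explicit. CLAIM (display; closure = `Skeleton.Lemma42`, see
`lemma42_iff`). [cite: Zhang2022LandauSiegel, §4 Lemma 4.2 p.17] [Z22 p.17, tex L926] -/
def FGProdBound (C : ℝ) (s : ℂ) : Prop :=
  ‖Skeleton.Fpoly χ x s * Skeleton.Gpoly χ x s - 1‖ ≤ C * (Skeleton.ell D ^ 227)⁻¹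

/-- **Z22:Lem4.2** is the banked node `Skeleton.Lemma42` ("for `ψ ∈ Ψ₁`, `s ∈ Ω₁`:
`FG = 1 + O(𝓛⁻²²⁷)`"), literally the `ForAllLarge`-closure of `FGProdBound`.
[cite: Zhang2022LandauSiegel, §4 Lemma 4.2 p.17] [Z22 p.17, tex L925] -/
theorem lemma42_iff : Skeleton.Lemma42 ↔ ∃ C : ℝ, Skeleton.ForAllLarge fun D _ χ =>
    ∀ x ∈ Skeleton.PsiOne χ, ∀ s ∈ Skeleton.Omega1 D, FGProdBound χ x C s := Iff.rfl

/-- The normalised coefficients `c₄(n) = ς(n)ψ(n)n^{−s₀}` of `X₄(x,ψ) = Σ_{D⁴<n≤x} c₄(n)`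
(§3 p.15). [cite: Zhang2022LandauSiegel, §4 Lemma 4.2 (proof) p.17] -/
def coefX4 (n : ℕ) : ℂ :=
  Skeleton.sig χ n * x.ψ (n : ZMod x.p) * (n : ℂ) ^ (-Skeleton.s0 D)

/-- `⌊D⁴⌋ = D⁴`, `⌊D⁸⌋ = D⁸` (cast bookkeeping). [folklore] -/
private theorem floor_pow4 (D : ℕ) : ⌊(D : ℝ) ^ 4⌋₊ = D ^ 4 := by
  rw [← Nat.cast_pow, Nat.floor_natCast]

omit [NeZero D] in
/-- `X₄(x,ψ)` is the partial-sum function `Lemma41.Xsum c₄ D⁴ x` of the tree's partial-integration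
file. [cite: Zhang2022LandauSiegel, §4 Lemma 4.2 (proof) p.17] -/
theorem X4_eq_Xsum (y : ℝ) : Skeleton.X4 χ x y = Lemma41.Xsum (coefX4 χ x) ((D : ℝ) ^ 4) y := by
  rw [Lemma41.Xsum_eq_sum_Ioc, floor_pow4]; rfl

/-- **Z22:§4.u007, first equality** — "`F(s,ψ)G(s,ψ) − 1 = Σ_{D⁴<n≤D⁸} ς(n)ψ(n)n^{−s}`"
(`ς(n) = Σ_{n=lm, l,m≤D⁴} ν(l)υ(m)`, which vanishes unless `n = 1` or `D⁴ < n ≤ D⁸`, §3 p.15).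
CLAIM (finite Dirichlet-series algebra plus `ν ∗ υ = δ`; not proved in this file).
[cite: Zhang2022LandauSiegel, §4 Lemma 4.2 (proof) p.17] [Z22 p.17, tex L933] -/
def FGSubOneExpansion (s : ℂ) : Prop :=
  Skeleton.Fpoly χ x s * Skeleton.Gpoly χ x s - 1 =
    ∑ n ∈ Finset.Ioc (D ^ 4) (D ^ 8), Skeleton.sig χ n * x.ψ (n : ZMod x.p) * (n : ℂ) ^ (-s)

/-- **Z22:§4.u007, second equality** — "`Σ_{D⁴<n≤D⁸} ς(n)ψ(n)n^{−s} = ∫_{D⁴}^{D⁸} x^{s₀−s} d{X₄(x,ψ)}`",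
rendered by parts: with `z = s₀ − s`,
`Σ_{D⁴<n≤D⁸} ς(n)ψ(n)n^{−s} = (D⁸)^{z}X₄(D⁸,ψ) − z∫_{D⁴}^{D⁸} X₄(x,ψ)x^{z−1}dx` (`X₄(D⁴) = 0`).
CLAIM — and a theorem (`stieltjesFG_of_one_le`, exact Abel summation).
[cite: Zhang2022LandauSiegel, §4 Lemma 4.2 (proof) p.17] [Z22 p.17, tex L933] -/
def StieltjesFG (s : ℂ) : Prop :=
  ∑ n ∈ Finset.Ioc (D ^ 4) (D ^ 8), Skeleton.sig χ n * x.ψ (n : ZMod x.p) * (n : ℂ) ^ (-s) =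
    (((D : ℝ) ^ 8 : ℝ) : ℂ) ^ (Skeleton.s0 D - s) * Skeleton.X4 χ x ((D : ℝ) ^ 8) -
      (Skeleton.s0 D - s) * ∫ y in (D : ℝ) ^ 4..(D : ℝ) ^ 8,
        Skeleton.X4 χ x y * (y : ℂ) ^ (Skeleton.s0 D - s - 1)

omit [NeZero D] in
/-- `c₄(n)·n^{s₀−s} = ς(n)ψ(n)n^{−s}` for `n ≥ 1`. [folklore] -/
private theorem coefX4_mul_cpow {n : ℕ} (hn : n ≠ 0) (s : ℂ) :
    coefX4 χ x n * (n : ℂ) ^ (Skeleton.s0 D - s) =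
      Skeleton.sig χ n * x.ψ (n : ZMod x.p) * (n : ℂ) ^ (-s) := by
  have hn' : (n : ℂ) ≠ 0 := Nat.cast_ne_zero.mpr hn
  rw [coefX4, mul_assoc, ← Complex.cpow_add _ _ hn']
  congr 2
  ring

omit [NeZero D] in
/-- **Z22:§4.u007 (second equality) holds**, by the tree's `Lemma41.sum_mul_cpow_eq` on `(D⁴, D⁸]`
(`D ≥ 1`). [cite: Zhang2022LandauSiegel, §4 Lemma 4.2 (proof) p.17] -/
theorem stieltjesFG_of_one_le (hD : 1 ≤ D) (s : ℂ) : StieltjesFG χ x s := by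
  have hD1 : (1 : ℝ) ≤ D := by exact_mod_cast hD
  have ha : (0 : ℝ) < (D : ℝ) ^ 4 := by positivity
  have hab : (D : ℝ) ^ 4 ≤ (D : ℝ) ^ 8 := pow_le_pow_right₀ hD1 (by norm_num)
  have key := Lemma41.sum_mul_cpow_eq (coefX4 χ x) ha hab (Skeleton.s0 D - s)
  have h8 : ⌊(D : ℝ) ^ 8⌋₊ = D ^ 8 := by rw [← Nat.cast_pow, Nat.floor_natCast]
  rw [floor_pow4, h8] at key
  have hsum : ∑ n ∈ Finset.Ioc (D ^ 4) (D ^ 8), coefX4 χ x n * (n : ℂ) ^ (Skeleton.s0 D - s) =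
      ∑ n ∈ Finset.Ioc (D ^ 4) (D ^ 8), Skeleton.sig χ n * x.ψ (n : ZMod x.p) * (n : ℂ) ^ (-s) :=
    Finset.sum_congr rfl fun n hn => coefX4_mul_cpow χ x (by
      have := (Finset.mem_Ioc.mp hn).1; omega) s
  rw [StieltjesFG, ← hsum, key]
  simp only [← X4_eq_Xsum]

/-- **Z22:§4.u008** — "by partial integration we obtain
`F(s,ψ)G(s,ψ) − 1 ≪ 𝓛⁴⁰⁶(|X₄(D⁸,ψ)| + ∫_{D⁴}^{D⁸} |X₄(x,ψ)|dx/x)`", with the implied constant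
explicit. CLAIM; given the expansion `FGSubOneExpansion` it is a theorem
(`fgPartialBound_of_expansion`, `C = 1`). [cite: Zhang2022LandauSiegel, §4 Lemma 4.2 (proof) p.17]
[Z22 p.17, tex L938] -/
def FGPartialBound (C : ℝ) (s : ℂ) : Prop :=
  ‖Skeleton.Fpoly χ x s * Skeleton.Gpoly χ x s - 1‖ ≤ C * Skeleton.ell D ^ 406 *
    (‖Skeleton.X4 χ x ((D : ℝ) ^ 8)‖ + ∫ y in (D : ℝ) ^ 4..(D : ℝ) ^ 8, ‖Skeleton.X4 χ x y‖ / y)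

omit [NeZero D] in
/-- **Edge for Z22:§4.u008**: for `D ≥ 2`, `𝓛 ≥ 32`, `s ∈ Ω₁`, the expansion of `FG − 1` gives the
display with `C = 1` (tree `Lemma41.norm_sum_Ioc_le` on `(D⁴, D⁸]`, `D⁸ ≤ e^{80𝓛}`).
[cite: Zhang2022LandauSiegel, §4 Lemma 4.2 (proof) p.17] -/
theorem fgPartialBound_of_expansion (hD : 1 ≤ D) (hL : 32 ≤ Skeleton.ell D) {s : ℂ}
    (hs : s ∈ Skeleton.Omega1 D) (hFG : FGSubOneExpansion χ x s) : FGPartialBound χ x 1 s := by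
  have hL1 : 1 ≤ Skeleton.ell D := by linarith
  have hL0 : 0 < Skeleton.ell D := by linarith
  have hD1 : (1 : ℝ) ≤ D := by exact_mod_cast hD
  obtain ⟨hz, hre, him⟩ := z_bounds hL hs
  have ha1 : (1 : ℝ) ≤ (D : ℝ) ^ 4 := one_le_pow₀ hD1
  have hab : (D : ℝ) ^ 4 ≤ (D : ℝ) ^ 8 := pow_le_pow_right₀ hD1 (by norm_num)
  have hbX : (D : ℝ) ^ 8 ≤ Real.exp (80 * Skeleton.ell D) :=
    (pow_le_pow_right₀ hD1 (by norm_num : 8 ≤ 80)).trans (pow80_eq_exp hD).le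
  have key := Lemma41.norm_sum_Ioc_le (coefX4 χ x) hL ha1 hab hbX hz hre him
  have h8 : ⌊(D : ℝ) ^ 8⌋₊ = D ^ 8 := by rw [← Nat.cast_pow, Nat.floor_natCast]
  rw [floor_pow4, h8] at key
  have hsum : ∑ n ∈ Finset.Ioc (D ^ 4) (D ^ 8), coefX4 χ x n * (n : ℂ) ^ (Skeleton.s0 D - s) =
      Skeleton.Fpoly χ x s * Skeleton.Gpoly χ x s - 1 := by
    rw [hFG]
    exact Finset.sum_congr rfl fun n hn => coefX4_mul_cpow χ x (by
      have := (Finset.mem_Ioc.mp hn).1; omega) s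
  rw [hsum] at key
  simp only [← X4_eq_Xsum] at key
  have hI0 : 0 ≤ ∫ y in (D : ℝ) ^ 4..(D : ℝ) ^ 8, ‖Skeleton.X4 χ x y‖ / y :=
    intervalIntegral.integral_nonneg hab fun y hy => div_nonneg (norm_nonneg _) (by linarith [hy.1])
  have h45 : Skeleton.ell D ^ (4 / 5 : ℝ) ≤ Skeleton.ell D ^ 406 := by
    rw [show (Skeleton.ell D ^ 406 : ℝ) = Skeleton.ell D ^ ((406 : ℕ) : ℝ) from
      (Real.rpow_natCast _ _).symm]
    exact Real.rpow_le_rpow_of_exponent_le hL1 (by norm_num)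
  have h406 : Skeleton.ell D ^ (406 : ℝ) = Skeleton.ell D ^ 406 := by
    rw [show (406 : ℝ) = ((406 : ℕ) : ℝ) by norm_num, Real.rpow_natCast]
  rw [h406] at key
  have hX0 : 0 ≤ ‖Skeleton.X4 χ x ((D : ℝ) ^ 8)‖ := norm_nonneg _
  unfold FGPartialBound
  nlinarith [mul_le_mul_of_nonneg_right h45 hX0, pow_nonneg hL0.le 406]

/-- `𝓛 ≥ 32` eventually (`𝓛 = log D → ∞`). [folklore] -/
private theorem thirtytwo_le_ell_of_le {D : ℕ} (hD : ⌈Real.exp 32⌉₊ ≤ D) : 32 ≤ Skeleton.ell D := by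
  have h : Real.exp 32 ≤ D := le_trans (Nat.le_ceil _) (by exact_mod_cast hD)
  exact (Real.le_log_iff_exp_le (lt_of_lt_of_le (Real.exp_pos _) h)).mpr h

/-- **Edge Z22:§4.u007 → Z22:Lem4.2** ("the right side being `O(𝓛⁻²²⁷)` by (3.6)"): if the
expansion `FG − 1 = Σ_{D⁴<n≤D⁸} ς(n)ψ(n)n^{−s}` holds identically, then the banked node
`Skeleton.Lemma42` holds, with `C = 1` — for `ψ ∈ Ψ₁` the inequality (3.6)
(`Skeleton.Ineq36`: `|X₄(D⁸)| + ∫_{D⁴}^{D⁸}|X₄|dx/x < 𝓛⁻⁶³³`) and `406 − 633 = −227`.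
[cite: Zhang2022LandauSiegel, §4 Lemma 4.2 (proof) p.17] -/
theorem lemma42_of_expansion
    (h : ∀ (D : ℕ) [NeZero D] (χ : DirichletCharacter ℂ D) (x : Skeleton.Chr D) (s : ℂ),
      FGSubOneExpansion χ x s) : Skeleton.Lemma42 := by
  refine ⟨1, ⌈Real.exp 32⌉₊, fun D _ χ hD _ _ x hx s hs => ?_⟩
  have hL : 32 ≤ Skeleton.ell D := thirtytwo_le_ell_of_le hD
  have hL0 : 0 < Skeleton.ell D := by linarith
  have hD1 : 1 ≤ D := le_trans (Nat.one_le_iff_ne_zero.mpr (by positivity)) hD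
  have hb := fgPartialBound_of_expansion χ x hD1 hL hs (h D χ x s)
  have h36 : ‖Skeleton.X4 χ x ((D : ℝ) ^ 8)‖ +
      ∫ y in (D : ℝ) ^ 4..(D : ℝ) ^ 8, ‖Skeleton.X4 χ x y‖ / y < (Skeleton.ell D ^ 633)⁻¹ := hx.2.2
  unfold FGPartialBound at hb
  have hpow : Skeleton.ell D ^ 406 * (Skeleton.ell D ^ 633)⁻¹ = (Skeleton.ell D ^ 227)⁻¹ := by
    rw [show (633 : ℕ) = 406 + 227 by norm_num, pow_add, mul_inv, ← mul_assoc,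
      mul_inv_cancel₀ (pow_ne_zero _ hL0.ne'), one_mul]
  calc ‖Skeleton.Fpoly χ x s * Skeleton.Gpoly χ x s - 1‖
      ≤ 1 * Skeleton.ell D ^ 406 * (‖Skeleton.X4 χ x ((D : ℝ) ^ 8)‖ +
          ∫ y in (D : ℝ) ^ 4..(D : ℝ) ^ 8, ‖Skeleton.X4 χ x y‖ / y) := hb
    _ ≤ 1 * Skeleton.ell D ^ 406 * (Skeleton.ell D ^ 633)⁻¹ :=
        mul_le_mul_of_nonneg_left h36.le (by positivity)
    _ = 1 * (Skeleton.ell D ^ 227)⁻¹ := by rw [mul_assoc, hpow]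

/-! ## Lemma 4.3 (Z22 p.17, tex L947–L973) -/

omit [NeZero D] in
/-- **Z22:§4.u009** — the region `Ω₂ = {s : 1/2 − 𝓛⁻¹ < σ < 1 + 𝓛⁻¹, |t − 2πt₀| < 𝓛₁ + 4}` of
Lemma 4.3, unfolded at the manuscript's parameters (`Skeleton.Omega2 D` = tree `Lemma43.Omega2`).
[cite: Zhang2022LandauSiegel, §4 Lemma 4.3 p.17] [Z22 p.17, tex L948] -/
theorem mem_Omega2_iff (D : ℕ) (s : ℂ) : s ∈ Skeleton.Omega2 D ↔
    1 / 2 - 1 / Skeleton.ell D < s.re ∧ s.re < 1 + 1 / Skeleton.ell D ∧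
      |s.im - 2 * π * Skeleton.t0 D| < Skeleton.ell1 D + 4 := Iff.rfl

/-- **Z22:§4.u010** — the display of Lemma 4.3, "`(F′/F)(s,ψ) = O(𝓛)`", pointwise with the
implied constant explicit. CLAIM (display; closure = `Skeleton.Lemma43`, see `lemma43_iff`).
[cite: Zhang2022LandauSiegel, §4 Lemma 4.3 p.17] [Z22 p.17, tex L952] -/
def LogDerivBound (C : ℝ) (s : ℂ) : Prop :=
  ‖deriv (Skeleton.Fpoly χ x) s / Skeleton.Fpoly χ x s‖ ≤ C * Skeleton.ell D

/-- **Z22:Lem4.3** is the banked node `Skeleton.Lemma43` ("for `ψ ∈ Ψ₁`, `s ∈ Ω₂`: `F′/F = O(𝓛)`"),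
literally the `ForAllLarge`-closure of `LogDerivBound`.
[cite: Zhang2022LandauSiegel, §4 Lemma 4.3 p.17] [Z22 p.17, tex L947] -/
theorem lemma43_iff : Skeleton.Lemma43 ↔ ∃ C : ℝ, Skeleton.ForAllLarge fun D _ χ =>
    ∀ x ∈ Skeleton.PsiOne χ, ∀ s ∈ Skeleton.Omega2 D, LogDerivBound χ x C s := Iff.rfl

omit [NeZero D] in
/-- The radius `(200𝓛)⁻¹log 𝓛` of the disc in `w` used in the proof of Lemma 4.3 ("Assume
`|w| ≤ (200𝓛)⁻¹log 𝓛`"). [cite: Zhang2022LandauSiegel, §4 Lemma 4.3 (proof) p.17] -/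
def discR (D : ℕ) : ℝ := Real.log (Skeleton.ell D) / (200 * Skeleton.ell D)

omit [NeZero D] in
/-- **Lemma 4.3, proof, first sentence**: "Assume `|w| ≤ (200𝓛)⁻¹log 𝓛`, so that `s + w ∈ Ω₁`"
(`s ∈ Ω₂`) — a theorem once `log 𝓛 ≥ 200` (tree `Lemma43.mem_Omega1_of_mem_Omega2`; the threshold
is one of the manuscript's "`D` sufficiently large"). [cite: Zhang2022LandauSiegel, §4 Lemma 4.3 (proof) p.17] -/
theorem mem_Omega1_of_mem_Omega2 {s w : ℂ} (hlog : 200 ≤ Real.log (Skeleton.ell D))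
    (hs : s ∈ Skeleton.Omega2 D) (hw : ‖w‖ ≤ discR D) : s + w ∈ Skeleton.Omega1 D := by
  have hℓ0 : 0 ≤ Skeleton.ell D := by unfold Skeleton.ell; exact Real.log_natCast_nonneg D
  have hL1 : 1 < Skeleton.ell D := by
    by_contra h
    push Not at h
    have := Real.log_nonpos hℓ0 h
    linarith
  have hL0 : 0 < Skeleton.ell D := by linarith
  have hsmall : Real.log (Skeleton.ell D) / (200 * Skeleton.ell D) ≤ 1 := by
    rw [div_le_iff₀ (by positivity)]
    have := Real.log_le_sub_one_of_pos hL0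
    linarith
  exact Lemma43.mem_Omega1_of_mem_Omega2 hL0 hlog hsmall hs hw

/-- **Z22:§4.u011** — "By Lemma 4.1 and 4.2, `𝓛⁻⁸⁸ ≪ |F(s+w,ψ)| ≪ 𝓛⁸⁸`" for `s ∈ Ω₂`,
`|w| ≤ (200𝓛)⁻¹log 𝓛`, with the two implied constants merged into one explicit `C ≥ 1`
(`C⁻¹𝓛⁻⁸⁸ ≤ |F| ≤ C𝓛⁸⁸`); as printed with the exponent `88` (Lemmas 4.1–4.2 give `79`). CLAIM.
[cite: Zhang2022LandauSiegel, §4 Lemma 4.3 (proof) p.17] [Z22 p.17, tex L958] -/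
def TwoSided88 (C : ℝ) (s : ℂ) : Prop :=
  ∀ w : ℂ, ‖w‖ ≤ discR D →
    C⁻¹ * (Skeleton.ell D ^ 88)⁻¹ ≤ ‖Skeleton.Fpoly χ x (s + w)‖ ∧
      ‖Skeleton.Fpoly χ x (s + w)‖ ≤ C * Skeleton.ell D ^ 88

/-- **Z22:§4.u012** — "the logarithm `𝔩(s,w) := log(F(s+w,ψ)/F(s,ψ))`, which vanishes at `w = 0`,
is analytic in `w`" (on `|w| ≤ (200𝓛)⁻¹log 𝓛`): typed as a predicate on a candidate branch
`𝔩 : ℂ → ℂ` — `𝔩(0) = 0`, `𝔩` holomorphic on the closed disc, `F(s+w,ψ) = F(s,ψ)e^{𝔩(w)}` there.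
CLAIM (existence of such an `𝔩` follows from u011: `F ≠ 0` on the disc).
[cite: Zhang2022LandauSiegel, §4 Lemma 4.3 (proof) p.17] [Z22 p.17, tex L962] -/
def IsLogBranch (s : ℂ) (𝔩 : ℂ → ℂ) : Prop :=
  𝔩 0 = 0 ∧ DifferentiableOn ℂ 𝔩 (Metric.closedBall 0 (discR D)) ∧
    ∀ w : ℂ, ‖w‖ ≤ discR D →
      Skeleton.Fpoly χ x (s + w) = Skeleton.Fpoly χ x s * Complex.exp (𝔩 w)

omit [NeZero D] in
/-- **Z22:§4.u013** — "and it satisfies `Re{𝔩(s,w)} ≪ log 𝓛`" (on the disc; the one-sided bound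
is what Borel–Carathéodory consumes), with the implied constant explicit, as a predicate on the
branch `𝔩`. CLAIM. [cite: Zhang2022LandauSiegel, §4 Lemma 4.3 (proof) p.17] [Z22 p.17, tex L966] -/
def ReLogBound (C : ℝ) (D : ℕ) (𝔩 : ℂ → ℂ) : Prop :=
  ∀ w : ℂ, ‖w‖ ≤ discR D → (𝔩 w).re ≤ C * Real.log (Skeleton.ell D)

/-- **Z22:§4.u014** — "Since `(F′/F)(s,ψ) = ∂/∂w 𝔩(s,w)|_{w=0}`", as a predicate on the branch `𝔩`.
CLAIM — and a theorem for every log branch (`logDerivEq_of_isLogBranch`).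
[cite: Zhang2022LandauSiegel, §4 Lemma 4.3 (proof) p.17] [Z22 p.17, tex L970] -/
def LogDerivEq (s : ℂ) (𝔩 : ℂ → ℂ) : Prop :=
  deriv (Skeleton.Fpoly χ x) s / Skeleton.Fpoly χ x s = deriv 𝔩 0

/-! ## The weight `g` (Z22 pp.17–18, tex L977–L1008) -/

omit [NeZero D] in
/-- **Z22:§4.u016** — `ω₁(w) = exp{w²/(4𝓛³⁰)}` at the manuscript's parameter (the tree's
`GaussWeight.omega1` at `Λ = 𝓛³⁰`). [cite: Zhang2022LandauSiegel, §4 p.18] [Z22 p.18, tex L982] -/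
def omega1W (D : ℕ) (w : ℂ) : ℂ := GaussWeight.omega1 (Skeleton.ell D ^ 30) w

omit [NeZero D] in
/-- Unfolding: `ω₁(w) = exp(w²/(4𝓛³⁰))`. [cite: Zhang2022LandauSiegel, §4 p.18] -/
theorem omega1W_apply (D : ℕ) (w : ℂ) :
    omega1W D w = Complex.exp (w ^ 2 / ((4 * Skeleton.ell D ^ 30 : ℝ) : ℂ)) := rfl

omit [NeZero D] in
/-- **Z22:§4.u015** — the DEFINITION display "`g(x) = (2πi)⁻¹∫_{(c)} x^w ω₁(w) dw/w` (`c > 0`)",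
typed as the claim that the banked `g = Skeleton.gW` (defined through (4.1)) equals this vertical
line integral for every `c > 0` and `x > 0`:
`(1/2π)∫_ℝ x^{c+it}ω₁(c+it)(c+it)⁻¹dt = g(x)`. CLAIM — and a theorem (`gVertical_of_ell_pos`, tree
`GaussWeight.gWeight_eq_verticalIntegral`). [cite: Zhang2022LandauSiegel, §4 p.17] [Z22 p.17, tex L978] -/
def GVertical (D : ℕ) : Prop :=
  ∀ c : ℝ, 0 < c → ∀ y : ℝ, 0 < y →
    (1 / (2 * π) : ℂ) * ∫ t : ℝ, (y : ℂ) ^ ((c : ℂ) + t * I) * omega1W D (c + t * I) / (c + t * I)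
      = (Skeleton.gW D y : ℂ)

omit [NeZero D] in
/-- **Z22:§4.u015 holds** (for `𝓛 > 0`, i.e. `D ≥ 2`). [cite: Zhang2022LandauSiegel, §4 p.17] -/
theorem gVertical_of_ell_pos (hL : 0 < Skeleton.ell D) : GVertical D := fun _ hc _ hy =>
  GaussWeight.gWeight_eq_verticalIntegral (pow_pos hL 30) hc hy

omit [NeZero D] in
/-- **Z22:§4.u017** — "We may write `g(x) = (2πi)⁻¹∫_{(c)} (∫₀ˣ y^{w−1}dy) ω₁(w) dw`"
(`x^w/w = ∫₀ˣ y^{w−1}dy` for `Re w > 0`). CLAIM.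
[cite: Zhang2022LandauSiegel, §4 p.18] [Z22 p.18, tex L986] -/
def GDouble (D : ℕ) : Prop :=
  ∀ c : ℝ, 0 < c → ∀ y : ℝ, 0 < y →
    (1 / (2 * π) : ℂ) * ∫ t : ℝ, (∫ u in (0 : ℝ)..y, (u : ℂ) ^ ((c : ℂ) + t * I - 1)) *
        omega1W D (c + t * I) = (Skeleton.gW D y : ℂ)

omit [NeZero D] in
/-- **Z22:§4.u018** — "Since `(2πi)⁻¹∫_{(c)} exp{(log y)w + w²/(4𝓛³⁰)}dw = (𝓛¹⁵/√π)exp{−𝓛³⁰(log y)²}`"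
(`y > 0`, any real `c`). CLAIM — and a theorem (`gaussLine_of_ell_pos`, tree
`GaussWeight.integral_omega1_mul_exp`). [cite: Zhang2022LandauSiegel, §4 p.18] [Z22 p.18, tex L990] -/
def GaussLine (D : ℕ) : Prop :=
  ∀ c : ℝ, ∀ y : ℝ, 0 < y →
    (1 / (2 * π) : ℂ) * ∫ t : ℝ, Complex.exp ((Real.log y : ℂ) * ((c : ℂ) + t * I) +
        ((c : ℂ) + t * I) ^ 2 / ((4 * Skeleton.ell D ^ 30 : ℝ) : ℂ))
      = ((Skeleton.ell D ^ 15 / Real.sqrt π * Real.exp (-(Skeleton.ell D ^ 30 * Real.log y ^ 2)) : ℝ) : ℂ)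

omit [NeZero D] in
/-- **Z22:§4.u018 holds** (for `𝓛 > 0`): `√(4π𝓛³⁰)/(2π) = 𝓛¹⁵/√π`.
[cite: Zhang2022LandauSiegel, §4 p.18] -/
theorem gaussLine_of_ell_pos (hL : 0 < Skeleton.ell D) : GaussLine D := by
  intro c y hy
  have hΛ : 0 < Skeleton.ell D ^ 30 := pow_pos hL 30
  have key := GaussWeight.integral_omega1_mul_exp hΛ c (Real.log y)
  have hint : ∫ t : ℝ, Complex.exp ((Real.log y : ℂ) * ((c : ℂ) + t * I) +
        ((c : ℂ) + t * I) ^ 2 / ((4 * Skeleton.ell D ^ 30 : ℝ) : ℂ)) =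
      ∫ t : ℝ, GaussWeight.omega1 (Skeleton.ell D ^ 30) (c + t * I) *
        Complex.exp ((c + t * I) * (Real.log y : ℝ)) := by
    refine MeasureTheory.integral_congr_ae (Filter.Eventually.of_forall fun t => ?_)
    simp only [GaussWeight.omega1, ← Complex.exp_add]
    congr 1
    push_cast
    ring
  rw [hint, key]
  have hsq : Real.sqrt (4 * π * Skeleton.ell D ^ 30) = 2 * Real.sqrt π * Skeleton.ell D ^ 15 := by
    rw [show 4 * π * Skeleton.ell D ^ 30 = (2 * Skeleton.ell D ^ 15) ^ 2 * π by ring,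
      Real.sqrt_mul (by positivity), Real.sqrt_sq (by positivity)]
    ring
  rw [GaussWeight.gauss, hsq, neg_mul]
  have hπ : Real.sqrt π ≠ 0 := (Real.sqrt_pos.mpr Real.pi_pos).ne'
  have hsπ : Real.sqrt π * Real.sqrt π = π := Real.mul_self_sqrt Real.pi_pos.le
  have hkey : 1 / (2 * π) * (2 * Real.sqrt π * Skeleton.ell D ^ 15) =
      Skeleton.ell D ^ 15 / Real.sqrt π := by
    rw [eq_div_iff hπ]
    calc 1 / (2 * π) * (2 * Real.sqrt π * Skeleton.ell D ^ 15) * Real.sqrt π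
        = 1 / (2 * π) * (2 * (Real.sqrt π * Real.sqrt π)) * Skeleton.ell D ^ 15 := by ring
      _ = Skeleton.ell D ^ 15 := by rw [hsπ]; field_simp
  have h2π : (1 / (2 * π) : ℂ) = ((1 / (2 * π) : ℝ) : ℂ) := by push_cast; ring
  rw [h2π, ← Complex.ofReal_mul, ← hkey]
  push_cast
  ring

omit [NeZero D] in
/-- **Z22:§4.u019** — "`g(x) = (𝓛¹⁵/√π)∫₀ˣ exp{−𝓛³⁰(log y)²}dy/y`" (`x > 0`). CLAIM (it is the
definition of `Skeleton.gW` after the substitution `y = e^u`; not re-derived here).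
[cite: Zhang2022LandauSiegel, §4 p.18] [Z22 p.18, tex L994] -/
def GLogForm (D : ℕ) : Prop :=
  ∀ y : ℝ, 0 < y →
    Skeleton.gW D y = Skeleton.ell D ^ 15 / Real.sqrt π *
      ∫ u in (0 : ℝ)..y, Real.exp (-(Skeleton.ell D ^ 30 * Real.log u ^ 2)) / u

omit [NeZero D] in
/-- **Z22:(4.1)** — "`g(x) = (1/√π)∫_{−∞}^{𝓛¹⁵log x} exp{−t²}dt`." CLAIM — and a theorem
(`eq41_of_ell_pos`: it is the erf form of the tree's `gWeight`, `√(𝓛³⁰) = 𝓛¹⁵`).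
[cite: Zhang2022LandauSiegel, §4 (4.1) p.18] [Z22 p.18, (4.1), tex L998] -/
def Eq41 (D : ℕ) : Prop :=
  ∀ y : ℝ, Skeleton.gW D y =
    1 / Real.sqrt π * ∫ t in Set.Iic (Skeleton.ell D ^ 15 * Real.log y), Real.exp (-t ^ 2)

omit [NeZero D] in
/-- **Z22:(4.1) holds** (for `𝓛 ≥ 0`, always: `𝓛 = log D ≥ 0`; needs `𝓛 > 0` for the tree lemma).
[cite: Zhang2022LandauSiegel, §4 (4.1) p.18] -/
theorem eq41_of_ell_pos (hL : 0 < Skeleton.ell D) : Eq41 D := by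
  intro y
  rw [Skeleton.gW, GaussWeight.gWeight_eq_erf_form (pow_pos hL 30)]
  congr 3
  rw [show Skeleton.ell D ^ 30 = (Skeleton.ell D ^ 15) ^ 2 by ring, Real.sqrt_sq (by positivity)]

omit [NeZero D] in
/-- **p.18, after (4.1)**: "Thus the function `g(x)` is increasing and it satisfies `0 < g(x) < 1`"
— positivity. A theorem (tree `GaussWeight.gWeight_pos`). [cite: Zhang2022LandauSiegel, §4 p.18] -/
theorem gW_pos (hL : 0 < Skeleton.ell D) (y : ℝ) : 0 < Skeleton.gW D y :=
  GaussWeight.gWeight_pos (pow_pos hL 30) y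

omit [NeZero D] in
/-- **p.18, after (4.1)**: "`g(x) < 1`". A theorem (tree `GaussWeight.gWeight_lt_one`).
[cite: Zhang2022LandauSiegel, §4 p.18] -/
theorem gW_lt_one (hL : 0 < Skeleton.ell D) (y : ℝ) : Skeleton.gW D y < 1 :=
  GaussWeight.gWeight_lt_one (pow_pos hL 30) y

omit [NeZero D] in
/-- **p.18, after (4.1)**: "`g(x)` is increasing" (on `x > 0`). A theorem (tree
`GaussWeight.gWeight_mono`). [cite: Zhang2022LandauSiegel, §4 p.18] -/
theorem gW_mono (hL : 0 < Skeleton.ell D) {y y' : ℝ} (hy : 0 < y) (hyy' : y ≤ y') :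
    Skeleton.gW D y ≤ Skeleton.gW D y' :=
  GaussWeight.gWeight_mono (pow_pos hL 30) hy hyy'

omit [NeZero D] in
/-- **Z22:(4.2)** — "`g(x) = 1 + O(exp{−𝓛³⁰log²x})` if `x ≥ 1`", with the implied constant
explicit. CLAIM — and a theorem (`eq42_of_ell_pos`, `C = 1/2`).
[cite: Zhang2022LandauSiegel, §4 (4.2) p.18] [Z22 p.18, (4.2), tex L1002] -/
def Eq42 (C : ℝ) (D : ℕ) : Prop :=
  ∀ y : ℝ, 1 ≤ y → |Skeleton.gW D y - 1| ≤ C * Real.exp (-(Skeleton.ell D ^ 30 * Real.log y ^ 2))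

omit [NeZero D] in
/-- **Z22:(4.2) holds** with `C = 1/2` (tree `GaussWeight.abs_gWeight_sub_one_le`).
[cite: Zhang2022LandauSiegel, §4 (4.2) p.18] -/
theorem eq42_of_ell_pos (hL : 0 < Skeleton.ell D) : Eq42 (1 / 2) D := by
  intro y hy
  have h := GaussWeight.abs_gWeight_sub_one_le (pow_pos hL 30) hy
  rw [Skeleton.gW]
  convert h using 2
  rw [neg_mul]

omit [NeZero D] in
/-- **Z22:(4.3)** — "`g(x) = O(exp{−𝓛³⁰log²x})` if `x ≤ 1`" (`0 < x ≤ 1`), with the implied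
constant explicit. CLAIM — and a theorem (`eq43_of_ell_pos`, `C = 1/2`).
[cite: Zhang2022LandauSiegel, §4 (4.3) p.18] [Z22 p.18, (4.3), tex L1006] -/
def Eq43 (C : ℝ) (D : ℕ) : Prop :=
  ∀ y : ℝ, 0 < y → y ≤ 1 → |Skeleton.gW D y| ≤ C * Real.exp (-(Skeleton.ell D ^ 30 * Real.log y ^ 2))

omit [NeZero D] in
/-- **Z22:(4.3) holds** with `C = 1/2` (tree `GaussWeight.gWeight_le`, `gWeight_pos`).
[cite: Zhang2022LandauSiegel, §4 (4.3) p.18] -/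
theorem eq43_of_ell_pos (hL : 0 < Skeleton.ell D) : Eq43 (1 / 2) D := by
  intro y hy hy1
  have hΛ : 0 < Skeleton.ell D ^ 30 := pow_pos hL 30
  rw [Skeleton.gW, abs_of_pos (GaussWeight.gWeight_pos hΛ y)]
  have h := GaussWeight.gWeight_le hΛ hy hy1
  convert h using 2
  rw [neg_mul]

/-! ## `Z̃` and (4.4)–(4.6) (Z22 pp.18–19, tex L1012–L1036) -/

/-- **Z22:§4.u020** — "Write `Z̃(s,ψ) = Z(s,ψ)Z(s,ψχ)`": the banked object `Skeleton.tildeZW`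
unfolded (`Z(s,ψ)` = `GammaFactor.Zfac ψ`, `Z(s,ψχ)` = `Skeleton.Zpc`).
[cite: Zhang2022LandauSiegel, §4 p.18] [Z22 p.18, tex L1014] -/
theorem tildeZW_eq (s : ℂ) :
    Skeleton.tildeZW χ x s = GammaFactor.Zfac x.ψ s * Skeleton.Zpc χ x s := rfl

/-- **Z22:(4.4)** — "`L(s,ψ)L(s,χψ) = Z̃(s,ψ)L(1−s,ψ̄)L(1−s,χψ̄)`" (`ψ̄ = ψ⁻¹`, `χψ̄ = (ψχ)⁻¹` for the
real `χ`; `Skeleton.LL = L(s,ψ)L(s,ψχ)`). CLAIM — and a theorem off the real axis given the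
primitivity of `ψχ` (`eq44_of_isPrimitive`; primitivity is the skeleton's discharged node `PsiChiPrimitive`).
[cite: Zhang2022LandauSiegel, §4 (4.4) p.18] [Z22 p.18, (4.4), tex L1018] -/
def Eq44 (s : ℂ) : Prop :=
  Skeleton.LL χ x s = Skeleton.tildeZW χ x s *
    (x.ψ⁻¹.LFunction (1 - s) * (Skeleton.psiChi χ x)⁻¹.LFunction (1 - s))

/-- **Z22:(4.4) holds** for `Im s ≠ 0`, given that `ψχ (mod Dp)` is primitive (tree
`GammaFactor.LFunction_mul_LFunction_eq`; `p ≠ 1`, `Dp ≠ 1`).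
[cite: Zhang2022LandauSiegel, §4 (4.4) p.18] -/
theorem eq44_of_isPrimitive (hprim : (Skeleton.psiChi χ x).IsPrimitive) {s : ℂ} (hs : s.im ≠ 0) :
    Eq44 χ x s := by
  have hDp : D * x.p ≠ 1 := fun h => x.p_ne_one (Nat.eq_one_of_mul_eq_one_left h)
  exact GammaFactor.LFunction_mul_LFunction_eq x.prim x.p_ne_one hprim hDp hs

omit [NeZero D] in
/-- **Z22:§4.u021** — the standing range of (4.5)–(4.6): "`|Re(s − s₀)| < 100`,
`|Im(s − s₀)| < 𝓛₁ + 3`". [cite: Zhang2022LandauSiegel, §4 p.18] [Z22 p.18, tex L1022] -/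
def InRange45 (D : ℕ) (s : ℂ) : Prop :=
  |(s - Skeleton.s0 D).re| < 100 ∧ |(s - Skeleton.s0 D).im| < Skeleton.ell1 D + 3

/-- **Z22:§4.u022** — "By (2.4) with `θ = ψ` and `θ = ψχ` we have
`Z̃(s,ψ) = χ(−1)τ(ψ)τ(ψχ)(Dp²)^{−s}ϑ(s)²(1 + O(e^{−πt}))`" in the range u021, with the implied
constant explicit (`τ` = `GammaFactor.tau`, `ϑ` = `GammaFactor.vartheta` (2.3)). CLAIM (the exact
two-factor form is the tree's `GammaFactor.tildeZ_eq`).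
[cite: Zhang2022LandauSiegel, §4 p.18] [Z22 p.18, tex L1026] -/
def TildeZFormula (C : ℝ) (s : ℂ) : Prop :=
  ∃ r : ℂ, ‖r‖ ≤ C * Real.exp (-π * s.im) ∧
    Skeleton.tildeZW χ x s = χ (-1) * (GammaFactor.tau x.ψ * GammaFactor.tau (Skeleton.psiChi χ x)) *
      (((D : ℝ) * (x.p : ℝ) ^ 2 : ℝ) : ℂ) ^ (-s) * GammaFactor.vartheta s ^ 2 * (1 + r)

/-- **Z22:(4.5)** — "This yields, by Stirling's formula, `|Z̃(s,ψ)| = (Dp²t₀²)^{1/2−σ}(1 + o(1))`"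
for `s` in the range u021, uniformly as `D → ∞`: for every `ε > 0`, eventually
`| |Z̃(s,ψ)| − M | ≤ εM`, `M = (Dp²t₀²)^{1/2−σ}`. CLAIM (Stirling with the parameter bookkeeping
`t = 2πt₀ + O(𝓛₁)`; the exact `t`-form is the tree's `GammaFactor.abs_norm_tildeZ_sub_le`).
[cite: Zhang2022LandauSiegel, §4 (4.5) p.18] [Z22 p.18, (4.5), tex L1030] -/
def Eq45 : Prop :=
  ∀ ε : ℝ, 0 < ε → Skeleton.ForAllLarge fun D _ χ => ∀ x : Skeleton.Chr D, ∀ s : ℂ,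
    InRange45 D s →
      |‖Skeleton.tildeZW χ x s‖ -
          (((D : ℝ) * (x.p : ℝ) ^ 2 * Skeleton.t0 D ^ 2) ^ (1 / 2 - s.re))| ≤
        ε * ((D : ℝ) * (x.p : ℝ) ^ 2 * Skeleton.t0 D ^ 2) ^ (1 / 2 - s.re)

/-- **Z22:(4.6)** — "and `(Z̃′/Z̃)(s,ψ) = −2log P + O(𝓛)`" for `s` in the range u021, with the
implied constant explicit inside `ForAllLarge`. CLAIM (the exact `t`-form is the tree's
`GammaFactor.norm_logDeriv_tildeZ_add_log_le`; `log p = log P + O(𝓛⁻⁶⁸)`, `log t₀ = 519 log 𝓛`).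
[cite: Zhang2022LandauSiegel, §4 (4.6) p.19] [Z22 p.19, (4.6), tex L1034] -/
def Eq46 : Prop :=
  ∃ C : ℝ, Skeleton.ForAllLarge fun D _ χ => ∀ x : Skeleton.Chr D, ∀ s : ℂ, InRange45 D s →
    ‖logDeriv (Skeleton.tildeZW χ x) s + 2 * Real.log (Skeleton.bigP D)‖ ≤ C * Skeleton.ell D

/-! ## A proved edge: `F′/F = ∂_w 𝔩|_{w=0}` for any log branch (Z22:§4.u014) -/

omit [NeZero D] in
/-- The Dirichlet polynomial `F(s,ψ)` is entire (a finite sum of `c·n^{−s}`, `n ≥ 1`).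
[cite: Zhang2022LandauSiegel, §4 Lemma 4.3 (proof) p.17] -/
theorem differentiable_Fpoly : Differentiable ℂ (Skeleton.Fpoly χ x) := by
  intro s
  unfold Skeleton.Fpoly
  refine DifferentiableAt.fun_sum fun n hn => ?_
  have hn0 : (n : ℂ) ≠ 0 := Nat.cast_ne_zero.mpr (by have := (Finset.mem_Icc.mp hn).1; omega)
  exact (differentiableAt_id.neg.const_cpow (Or.inl hn0)).const_mul _

omit [NeZero D] in
/-- **Z22:§4.u014 holds** for every log branch of u012 with `F(s,ψ) ≠ 0` and `(200𝓛)⁻¹log 𝓛 > 0`: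
differentiating `F(s+w) = F(s)e^{𝔩(w)}` at `w = 0`. [cite: Zhang2022LandauSiegel, §4 Lemma 4.3 (proof) p.17] -/
theorem logDerivEq_of_isLogBranch {s : ℂ} {𝔩 : ℂ → ℂ} (hr : 0 < discR D)
    (hF : Skeleton.Fpoly χ x s ≠ 0) (h : IsLogBranch χ x s 𝔩) : LogDerivEq χ x s 𝔩 := by
  obtain ⟨h0, hdiff, hexp⟩ := h
  -- `𝔩` is differentiable at `0` (interior point of the closed disc)
  have hl : DifferentiableAt ℂ 𝔩 0 :=
    (hdiff 0 (Metric.mem_closedBall_self hr.le)).differentiableAt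
      (Metric.closedBall_mem_nhds 0 hr)
  -- `w ↦ F(s+w)` agrees with `w ↦ F(s)·exp(𝔩 w)` near `0`
  have hev : (fun w => Skeleton.Fpoly χ x (s + w)) =ᶠ[nhds 0]
      fun w => Skeleton.Fpoly χ x s * Complex.exp (𝔩 w) := by
    filter_upwards [Metric.closedBall_mem_nhds (0 : ℂ) hr] with w hw
    exact hexp w (by simpa using hw)
  have hd2 : HasDerivAt (fun w => Skeleton.Fpoly χ x s * Complex.exp (𝔩 w))
      (Skeleton.Fpoly χ x s * (Complex.exp (𝔩 0) * deriv 𝔩 0)) 0 :=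
    (hl.hasDerivAt.cexp).const_mul _
  have hd1 : HasDerivAt (fun w => Skeleton.Fpoly χ x (s + w))
      (Skeleton.Fpoly χ x s * (Complex.exp (𝔩 0) * deriv 𝔩 0)) 0 :=
    hd2.congr_of_eventuallyEq hev
  -- chain rule the other way: `d/dw F(s+w)|₀ = F′(s)`
  have hd3 : HasDerivAt (fun w => Skeleton.Fpoly χ x (s + w)) (deriv (Skeleton.Fpoly χ x) s) 0 := by
    have hFd : HasDerivAt (Skeleton.Fpoly χ x) (deriv (Skeleton.Fpoly χ x) s) (s + 0) := by
      rw [add_zero]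
      exact (differentiable_Fpoly χ x s).hasDerivAt
    exact hFd.comp_const_add s 0
  have heq := hd3.unique hd1
  rw [h0, Complex.exp_zero, one_mul] at heq
  rw [LogDerivEq, heq, mul_div_cancel_left₀ _ hF]

end Literature.NumberTheory.LFunctions.Zhang2022.Typed.Section04A
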